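import Summits.AtomisticToContinuum.HydrodynamicLimit.Theorems.LambertianContactSwapContactAngleEquidistributionEqCrux
import Literature.MathematicalPhysics.KineticTheory.HardSphereCampbellFormulaHolds
import HarnessLib

/-!
# The equilibrium crux, UNCONDITIONAL (line `Sketch` v6, crux
# `LambertianContactSwap.ContactAngleEquidistribution`, stmt-AtomisticToContinuum-12097; lead c3)

Helper file (`--supports stmt-AtomisticToContinuum-12097`). Lead c2 proved THE EQUILIBRIUM CRUX
`stub_eqCrux` (`…EqCrux.lean`, p126260): under the homogeneous Gibbs law the mean of the crux functional of
`ContactAngleEquidistribution` tends to `0` for every admissible test function — CONDITIONAL on ONE named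
fact, Cercignani–Illner–Pulvirenti's special-flow / Campbell identity
`Literature.MathematicalPhysics.KineticTheory.HardSphereCampbellFormula` (1994, App. 4.A). Cycle 4 of the
line (lead c3) DISCHARGED that fact in the Literature tree
(`Literature.MathematicalPhysics.KineticTheory.hardSphereCampbellFormula_holds`, file
`Literature/MathematicalPhysics/KineticTheory/HardSphereCampbellFormulaHolds.lean`, with its 14 sibling
`HardSphereCampbell*` files: the GST hit-piece / pre-collision-cylinder engine, stationarity, the sharp
collision-count bound, the flux-null set, monotone limits). This file records the consequence: the
equilibrium crux holds with NO named-fact hypothesis (`eq_contactAngleEquidistribution_unconditional`).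
What the crux as filed still lacks is unchanged and out of equilibrium (`stub_cost`, T1', T2', item 12102:
open-problem class, see `Cruxes/ContactAngleEquidistribution/NOTES.md`).

References: C. Cercignani, R. Illner, M. Pulvirenti, *The Mathematical Theory of Dilute Gases*, Springer
(1994), §4.2, App. 4.A pp. 107–111; D. Ruelle, *Statistical Mechanics: Rigorous Results* (1969), §4.2.3.
-/

noncomputable section

open MeasureTheory Filter Set Topology ProbabilityTheory
open scoped ENNReal BigOperators Classical RealInnerProductSpace

namespace Summit.AtomisticToContinuum.HydrodynamicLimit.Theorems.ContactAngleEquidistributionSketch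

open Literature.Analysis.FluidPDE Literature.MathematicalPhysics.KineticTheory

/-- **THE EQUILIBRIUM CRUX, UNCONDITIONAL** (line `Sketch` v6, crux ContactAngleEquidistribution,
stmt-AtomisticToContinuum-12097): for every `θ > 0` there is `σ₀ > 0` such that for all `0 < σ < σ₀`, all
families of hard-sphere flow structures `Φ`, all `t ≥ 0` and ALL admissible test functions
`ψ_N (s, x, v, v_*, n)` (jointly measurable, `|ψ_N| ≤ 1`), the mean under the homogeneous Gibbs law
`Q_N = localGibbsLaw σ 1 0 θ N (Φ N)` of the crux functional — the normalised `|g|²`-weighted collision sum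
of `κ_g`-centred marks over Alexander's construction, VERBATIM the body of `ContactAngleEquidistribution` —
tends to `0` as `N → ∞`: contact-normal equidistribution given the pair holds at equilibrium at fixed
reduced density, with no named-fact hypothesis (`stub_eqCrux` with `HardSphereCampbellFormula` discharged
by `hardSphereCampbellFormula_holds`). [cite: CIP1994, App. 4.A pp. 107–111; Ruelle1969, §4.2.3 Thm 4.2.3] -/
theorem eq_contactAngleEquidistribution_unconditional :
    let Cfg : ℕ → Type := fun N => Config (N + 1) (Fin 3) T3
    let G := Torus.geometry (Fin 3)
    let ε : ℝ → ℕ → ℝ := hsDiameter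
    let τ : ℝ → (N : ℕ) → Cfg N → ℝ≥0∞ := fun σ N z => Alexander.freeExitTime G (ε σ N) z
    let S : ℝ → (N : ℕ) → Cfg N → Cfg N := fun t _ z => freeFlight G t z
    let ldir : V3 → V3 → V3 := fun ω ξ => ‖‖ω‖⁻¹ • ω + ‖ξ‖⁻¹ • ξ‖⁻¹ • (‖ω‖⁻¹ • ω + ‖ξ‖⁻¹ • ξ)
    let zpre : ℝ → (N : ℕ) → Cfg N → ℕ → Cfg N := fun σ N z m =>
      let y := Alexander.stateAfter G (ε σ N) z m; S (τ σ N y).toReal N y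
    let Kt : ℝ → (N : ℕ) → Cfg N → ℝ → ℕ := fun σ N z t => Alexander.collisionCount G (ε σ N) z t
    let hit : ℝ → (N : ℕ) → Cfg N → Fin (N + 1) → Fin (N + 1) → Prop := fun σ N y i j =>
      i < j ∧ y ∈ contactSet G (N + 1) (ε σ N) i j ∧ IsIncoming G y i j
    let tcol : ℝ → (N : ℕ) → Cfg N → ℕ → ℝ := fun σ N z m =>
      (Alexander.collisionInstant G (ε σ N) z (m + 1)).toReal
    let xmid : (N : ℕ) → Cfg N → Fin (N + 1) → Fin (N + 1) → T3 := fun _ y i j =>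
      G.translate (y j).1 ((2 : ℝ)⁻¹ • G.sepVec (y i).1 (y j).1)
    ∀ θ : ℝ, 0 < θ → ∃ σ₀ : ℝ, 0 < σ₀ ∧ ∀ σ : ℝ, 0 < σ → σ < σ₀ →
      ∀ Φ : (N : ℕ) → HardSphereFlow G (ε σ N) (N + 1),
      let Q := fun N => localGibbsLaw σ (fun _ => 1) (fun _ => 0) (fun _ => θ) N (Φ N)
      ∀ t : ℝ, 0 ≤ t → ∀ ψ : ℕ → ℝ → T3 → V3 → V3 → V3 → ℝ,
        (∀ N, Measurable (fun p : ℝ × T3 × V3 × V3 × V3 =>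
          ψ N p.1 p.2.1 p.2.2.1 p.2.2.2.1 p.2.2.2.2)) →
        (∀ N s x v w n, |ψ N s x v w n| ≤ 1) →
        Tendsto (fun N : ℕ => ∫ z, ((N : ℝ) + 1) ^ (-(4 / 3 : ℝ)) *
          ∑ m ∈ Finset.range (Kt σ N z t), ∑ i : Fin (N + 1), ∑ j : Fin (N + 1),
            (let y := zpre σ N z m
             if hit σ N y i j then
               ‖(y i).2 - (y j).2‖ ^ 2 *
                 (ψ N (tcol σ N z m) (xmid N y i j) (y i).2 (y j).2 ((ε σ N)⁻¹ • G.sepVec (y i).1 (y j).1) -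
                   ∫ ξ, ψ N (tcol σ N z m) (xmid N y i j) (y i).2 (y j).2 (ldir (-((y i).2 - (y j).2)) ξ)
                     ∂(stdGaussian V3))
             else 0) ∂(Q N)) atTop (𝓝 0) :=
  stub_eqCrux hardSphereCampbellFormula_holds

end Summit.AtomisticToContinuum.HydrodynamicLimit.Theorems.ContactAngleEquidistributionSketch

end
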